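import Summits.CriticalPhenomena.Ising3D.Control2DTermwise
import Literature.NumberTheory.Automorphic.ZhouLegendreGreenValuesProofs
import Mathlib.Analysis.SpecificLimits.Basic
import Mathlib.Tactic.NormNum
import Mathlib.Tactic.FieldSimp
import Mathlib.Tactic.Positivity
import HarnessLib

/-!
# The 2D control: the stress-tensor chiral block `k_4 = x² ₂F₁(2,2;4;x)` enclosed by rational partial sums
(cell `pub-ising3x`, seat controls-1; companion of `Control2DTermwise.lean`)

HONEST FRAMING: lottery ticket; floor = tightest certified 3D Ising CFT bounds; no exact-solution
claim without a proof.

The OPE certificates of the 2D control evaluate the block of `T ⊕ T̄`, `g_T(x,y) = k_4(x) + k_4(y)`,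
`k_4(x) = chiralBlock 2 x = x² ₂F₁(2,2;4;x) = Σ_m c_m x^(m+2)`, `c_m = 6(m+1)/((m+2)(m+3))`. This file
makes `k_4` KERNEL-EVALUABLE to any accuracy: `k4c` (the coefficients by their recursion, computable over
`ℚ`; closed form `k4c_eq`; `k4c_cast : (k4c m : ℝ) = chiralCoeff 2 m` from the hypergeometric coefficient
recurrence), the enclosures `k4lo N x = x² Σ_(m<N) c_m x^m` and `k4hi N x = k4lo N x + 6x^(N+2)/(1-x)`, and
`k4_mem : k4lo N x ≤ k_4(x) ≤ k4hi N x` for rational `0 < x < 1` (PROVED: non-negative terms below,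
`c_m ≤ 6` and the geometric series above). It is the first kernel enclosure of a `₂F₁` block value in the
cell — the partial-sum-plus-tail technique a Lean port of the verifiers' obligations (C)/(M) would scale up.

Sources: Dolan–Osborn 2004 §3 (the `ε = 0` blocks); Andrews–Askey–Roy 1999 §2.1/§2.3 via the tree's
`LegendreP.hasSum_ordinaryHypergeometric` / `ordinaryHypergeometricCoefficient_succ_rec`. Mathlib:
`hasSum_geometric_of_lt_one`, `Summable.sum_add_tsum_nat_add`, `sum_le_hasSum`.
-/

namespace Summit.CriticalPhenomena.Ising3D.Control2D

open Set Finset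
open Literature.MathematicalPhysics.QuantumFieldTheory.ConformalBootstrap3D

/-- The coefficients of `k_4(x) = Σ_m c_m x^(m+2)` by their recursion `c_0 = 1`,
`c_(m+1) = c_m (m+2)²/((m+1)(m+4))` (computable over `ℚ`). [folklore] -/
def k4c : ℕ → ℚ
  | 0 => 1
  | m + 1 => k4c m * (((m : ℚ) + 2) ^ 2 / (((m : ℚ) + 1) * ((m : ℚ) + 4)))

/-- Closed form `c_m = 6(m+1)/((m+2)(m+3))`. [folklore] -/
theorem k4c_eq (m : ℕ) : k4c m = 6 * ((m : ℚ) + 1) / (((m : ℚ) + 2) * ((m : ℚ) + 3)) := by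
  induction m with
  | zero => simp [k4c]; norm_num
  | succ n ih =>
    rw [k4c, ih]
    have h1 : ((n : ℚ) + 2) ≠ 0 := by positivity
    have h2 : ((n : ℚ) + 3) ≠ 0 := by positivity
    have h3 : ((n : ℚ) + 1) ≠ 0 := by positivity
    have h4 : ((n : ℚ) + 4) ≠ 0 := by positivity
    push_cast
    field_simp
    ring

/-- `0 ≤ c_m ≤ 6`. [folklore] -/
theorem k4c_nonneg_le (m : ℕ) : 0 ≤ k4c m ∧ k4c m ≤ 6 := by
  rw [k4c_eq]
  have h2 : (0 : ℚ) < (m : ℚ) + 2 := by positivity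
  have h3 : (0 : ℚ) < (m : ℚ) + 3 := by positivity
  constructor
  · positivity
  · rw [div_le_iff₀ (by positivity)]
    nlinarith

/-- The recursion-defined coefficients are Mathlib's hypergeometric coefficients of `₂F₁(2,2;4;·)`:
`(k4c m : ℝ) = chiralCoeff 2 m`. [folklore] -/
theorem k4c_cast (m : ℕ) : ((k4c m : ℚ) : ℝ) = chiralCoeff 2 m := by
  induction m with
  | zero =>
    simp [k4c, chiralCoeff, ordinaryHypergeometricCoefficient]
  | succ n ih =>
    have hrec := Literature.NumberTheory.Automorphic.LegendreP.ordinaryHypergeometricCoefficient_succ_rec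
      (2 : ℝ) 2 (2 * 2) n (by positivity)
    have hc : chiralCoeff 2 (n + 1) = chiralCoeff 2 n * (((n : ℝ) + 2) ^ 2 / (((n : ℝ) + 1) * ((n : ℝ) + 4))) := by
      unfold chiralCoeff
      generalize ordinaryHypergeometricCoefficient (2 : ℝ) 2 (2 * 2) (n + 1) = A1 at hrec ⊢
      generalize ordinaryHypergeometricCoefficient (2 : ℝ) 2 (2 * 2) n = A0 at hrec ⊢
      rw [mul_div_assoc', eq_div_iff (by positivity)]
      linear_combination hrec
    rw [hc, ← ih]
    simp [k4c]

/-- Lower enclosure of `k_4`: the partial sum `x² Σ_(m<N) c_m x^m`. [folklore] -/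
def k4lo (N : ℕ) (x : ℚ) : ℚ := x ^ 2 * ∑ m ∈ Finset.range N, k4c m * x ^ m

/-- Upper enclosure of `k_4`: partial sum plus the geometric tail `6 x^(N+2)/(1-x)` (`c_m ≤ 6`).
[folklore] -/
def k4hi (N : ℕ) (x : ℚ) : ℚ := k4lo N x + 6 * x ^ (N + 2) / (1 - x)

/-- `k4lo N x ≥ 0` for `x ≥ 0`. [folklore] -/
theorem k4lo_nonneg (N : ℕ) {x : ℚ} (hx : 0 ≤ x) : 0 ≤ k4lo N x := by
  unfold k4lo
  exact mul_nonneg (by positivity)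
    (Finset.sum_nonneg fun m _ => mul_nonneg (k4c_nonneg_le m).1 (pow_nonneg hx m))

/-- `k_4` as a `HasSum` with natural powers: `k_4(x) = Σ_m c_m x^(m+2)` for `0 < x < 1`. [folklore] -/
theorem hasSum_k4 {x : ℝ} (hx0 : 0 < x) (hx1 : x < 1) :
    HasSum (fun m : ℕ => ((k4c m : ℚ) : ℝ) * (x ^ 2 * x ^ m)) (chiralBlock 2 x) := by
  have H := hasSum_chiralBlock 2 hx0 hx1
  have hfun : (fun m : ℕ => chiralCoeff 2 m * x ^ ((2 : ℝ) + (m : ℝ))) =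
      fun m : ℕ => ((k4c m : ℚ) : ℝ) * (x ^ 2 * x ^ m) := by
    funext m
    rw [k4c_cast, Real.rpow_add hx0, Real.rpow_natCast,
      show (x ^ (2 : ℝ)) = x ^ 2 by exact_mod_cast Real.rpow_natCast x 2]
  rw [← hfun]
  exact H

/-- **The enclosure `k4lo N x ≤ k_4(x) ≤ k4hi N x`** for rational `0 < x < 1`. PROVED (non-negative
terms; tail against the geometric series). [folklore] -/
theorem k4_mem {x : ℚ} (hx0 : 0 < x) (hx1 : x < 1) (N : ℕ) :
    ((k4lo N x : ℚ) : ℝ) ≤ chiralBlock 2 x ∧ chiralBlock 2 x ≤ ((k4hi N x : ℚ) : ℝ) := by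
  have hx0' : (0 : ℝ) < (x : ℝ) := by exact_mod_cast hx0
  have hx1' : ((x : ℚ) : ℝ) < 1 := by exact_mod_cast hx1
  have H := hasSum_k4 hx0' hx1'
  have hnn : ∀ m, (0 : ℝ) ≤ ((k4c m : ℚ) : ℝ) * ((x : ℝ) ^ 2 * (x : ℝ) ^ m) := fun m =>
    mul_nonneg (by exact_mod_cast (k4c_nonneg_le m).1) (by positivity)
  have hlo : ((k4lo N x : ℚ) : ℝ) = ∑ m ∈ Finset.range N, ((k4c m : ℚ) : ℝ) * ((x : ℝ) ^ 2 * (x : ℝ) ^ m) := by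
    simp only [k4lo]
    push_cast
    rw [Finset.mul_sum]
    refine Finset.sum_congr rfl fun m _ => ?_
    ring
  constructor
  · rw [hlo]
    exact sum_le_hasSum (Finset.range N) (fun m _ => hnn m) H
  · -- tail: Σ_(m ≥ N) c_m x^(m+2) ≤ 6 x^(N+2) Σ_j x^j = 6 x^(N+2)/(1-x)
    have hsplit := H.summable.sum_add_tsum_nat_add N
    have htot : ∑' m, ((k4c m : ℚ) : ℝ) * ((x : ℝ) ^ 2 * (x : ℝ) ^ m) = chiralBlock 2 x := H.tsum_eq
    have hgeom : HasSum (fun j : ℕ => (6 : ℝ) * (x : ℝ) ^ (N + 2) * (x : ℝ) ^ j)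
        (6 * (x : ℝ) ^ (N + 2) * (1 - (x : ℝ))⁻¹) :=
      (hasSum_geometric_of_lt_one hx0'.le hx1').mul_left _
    have htail_le : ∑' j, ((k4c (j + N) : ℚ) : ℝ) * ((x : ℝ) ^ 2 * (x : ℝ) ^ (j + N)) ≤
        6 * (x : ℝ) ^ (N + 2) * (1 - (x : ℝ))⁻¹ := by
      have hs1 : Summable (fun j : ℕ => ((k4c (j + N) : ℚ) : ℝ) * ((x : ℝ) ^ 2 * (x : ℝ) ^ (j + N))) :=
        (summable_nat_add_iff N).mpr H.summable
      rw [← hgeom.tsum_eq]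
      refine Summable.tsum_le_tsum (fun j => ?_) hs1 hgeom.summable
      have hc6 : ((k4c (j + N) : ℚ) : ℝ) ≤ 6 := by exact_mod_cast (k4c_nonneg_le (j + N)).2
      have hxp : (0 : ℝ) ≤ (x : ℝ) ^ 2 * (x : ℝ) ^ (j + N) := by positivity
      calc ((k4c (j + N) : ℚ) : ℝ) * ((x : ℝ) ^ 2 * (x : ℝ) ^ (j + N))
          ≤ 6 * ((x : ℝ) ^ 2 * (x : ℝ) ^ (j + N)) := mul_le_mul_of_nonneg_right hc6 hxp
        _ = 6 * (x : ℝ) ^ (N + 2) * (x : ℝ) ^ j := by ring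
    have hhi : ((k4hi N x : ℚ) : ℝ) = ((k4lo N x : ℚ) : ℝ) + 6 * (x : ℝ) ^ (N + 2) * (1 - (x : ℝ))⁻¹ := by
      simp only [k4hi]
      push_cast
      rw [div_eq_mul_inv]
    rw [hhi, hlo, ← htot, ← hsplit]
    linarith

/-- `k_4(x) + k_4(y) = globalBlock 2 2 (x, y)`: the block of `T ⊕ T̄`. [folklore] -/
theorem globalBlock_two_two (x y : ℝ) : globalBlock 2 2 x y = chiralBlock 2 x + chiralBlock 2 y := by
  have e1 : ((2 : ℝ) + ((2 : ℕ) : ℝ)) / 2 = 2 := by norm_num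
  have e2 : ((2 : ℝ) - ((2 : ℕ) : ℝ)) / 2 = 0 := by norm_num
  simp only [globalBlock, e1, e2, chiralBlock_zero]
  ring

end Summit.CriticalPhenomena.Ising3D.Control2D
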